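import Literature.AnabelianGeometry.SemiGraphs.BTempStructureProofs
import Literature.AnabelianGeometry.SemiGraphs.BTempCoproductsProofs
import Mathlib.GroupTheory.GroupAction.SubMulAction
import HarnessLib

/-!
# Semi-graphs of anabelioids, §3: `B^temp(Π)` is almost totally epimorphic of countably connected type

Mochizuki, *Semi-graphs of anabelioids*, Publ. RIMS **42** (2006), §3, Remark 3.1.5 p. 34
[cite: MochizukiSemiAnbd2006, Rmk 3.1.5 p.34]: "It is immediate from the definitions that every
temperoid is an almost totally epimorphic category of countably connected type [cf. §0]."  This
proof-only file proves the second clause for the connected temperoids `B^temp(Π)` themselves (the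
first clause is `BTemp.epi_of_isConnectedObj` of `BTempStructureProofs.lean`; the general
temperoid, a countable product of these, is the named fact `TemperoidAlmostTotallyEpimorphic` of
`Temperoids.lean`, assembled by its holder from these inputs):

* `BTemp.isOfCountablyConnectedType` — countable coproducts exist
  (`BTemp.hasCountableCoproducts`); every countable discrete continuous `Π`-set is the coproduct
  of its (countably many) orbits, each a connected object (`BTemp.exists_cofan_orbits`); and a
  morphism from a connected (= transitive nonempty) object into a colimit cofan factors through
  exactly one leg (`BTemp.cofan_bijective`), colimit cofans being disjoint unions on points.

Proof-only: no definitions.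
-/

namespace Literature.AnabelianGeometry.SemiGraphs

open CategoryTheory CategoryTheory.Limits Topology
open Literature.AlgebraicGeometry.Frobenioids (IsConnectedObj IsNonemptyObj IsOfCountablyConnectedType)

universe u

variable {G : Type u} [Group G] [TopologicalSpace G]

/-- Equivariance of a morphism of `B^temp(Π)`, pointwise. [folklore] -/
private theorem hom_ρ'' {X Y : BTemp G} (f : X ⟶ Y) (g : G) (x : X.obj.V) :
    f.hom.hom (X.obj.ρ g x) = Y.obj.ρ g (f.hom.hom x) := by
  have e := ConcreteCategory.congr_hom (f.hom.comm g) x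
  simp only [types_comp_apply] at e
  exact e

/-- **Orbit decomposition**: every object of `B^temp(Π)` is the coproduct (colimit cofan over a
countable index type) of its orbits, which are connected objects.
[cite: MochizukiSemiAnbd2006, Rmk 3.1.5 p.34] -/
theorem BTemp.exists_cofan_orbits (A : BTemp G) :
    ∃ (ι : Type) (_ : Countable ι) (X : ι → BTemp G), (∀ i, IsConnectedObj (X i)) ∧
      ∃ c : Cofan X, Nonempty (IsColimit c) ∧ Nonempty (c.pt ≅ A) := by
  classical
  letI : MulAction G A.obj.V := Action.instMulAction A.obj
  haveI : Countable A.obj.V := A.property.1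
  -- a universe-`0` copy of the (countable) orbit space
  obtain ⟨f, hf⟩ := Countable.exists_injective_nat (MulAction.orbitRel.Quotient G A.obj.V)
  let e : MulAction.orbitRel.Quotient G A.obj.V ≃ Set.range f := Equiv.ofInjective f hf
  -- the orbits as sub-`Π`-sets and as objects of `B^temp(Π)`
  let S : MulAction.orbitRel.Quotient G A.obj.V → SubMulAction G A.obj.V := fun ω =>
    { carrier := ω.orbit
      smul_mem' := fun g {a} ha => by
        rw [MulAction.orbitRel.Quotient.mem_orbit] at ha ⊢
        rw [← ha]
        exact Quotient.sound (MulAction.orbitRel_apply.mpr (MulAction.mem_orbit a g)) }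
  have memS : ∀ (ω) (a : A.obj.V), a ∈ S ω ↔ Quotient.mk'' a = ω := fun ω a =>
    MulAction.orbitRel.Quotient.mem_orbit
  let B : MulAction.orbitRel.Quotient G A.obj.V → BTemp G := fun ω =>
    ⟨{ V := S ω, ρ := (Action.ofMulAction G (S ω)).ρ }, by
      refine ⟨inferInstanceAs (Countable (S ω)), fun (y : S ω) => ?_⟩
      change IsOpen {g : G | (Action.ofMulAction G (S ω)).ρ g y = y}
      have : {g : G | (Action.ofMulAction G (S ω)).ρ g y = y} = {g : G | A.obj.ρ g y.1 = y.1} := by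
        ext g
        simp only [Set.mem_setOf_eq]
        change g • y = y ↔ g • (y.1 : A.obj.V) = y.1
        rw [Subtype.ext_iff, SubMulAction.val_smul]
      rw [this]
      exact A.property.2 y.1⟩
  let X : Set.range f → BTemp G := fun i => B (e.symm i)
  let inj : ∀ i, X i ⟶ A := fun i =>
    ObjectProperty.homMk
      { hom := TypeCat.ofHom fun y : S (e.symm i) => (y.1 : A.obj.V)
        comm := fun _ => by
          apply ConcreteCategory.hom_ext
          intro y
          rfl }
  -- connectedness of the orbits
  have hconn : ∀ i, IsConnectedObj (X i) := by
    intro i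
    rw [BTemp.isConnectedObj_iff]
    constructor
    · obtain ⟨a, ha⟩ := Quotient.exists_rep (e.symm i)
      exact ⟨⟨a, (memS _ a).mpr ha⟩⟩
    · rintro ⟨y, hy⟩ ⟨y', hy'⟩
      have h : (Quotient.mk'' y' : MulAction.orbitRel.Quotient G A.obj.V) = Quotient.mk'' y := by
        rw [(memS _ y).mp hy, (memS _ y').mp hy']
      obtain ⟨g, hg⟩ := MulAction.orbitRel_apply.mp (Quotient.exact' h)
      exact ⟨g, Subtype.ext hg⟩
  -- dependent-index bookkeeping
  have hdep : ∀ (t : Cofan X) (i i' : Set.range f) (h : i = i') (a : A.obj.V)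
      (ha : a ∈ S (e.symm i)) (ha' : a ∈ S (e.symm i')),
      ((t.inj i).hom.hom (⟨a, ha⟩ : S (e.symm i)) : t.pt.obj.V) = (t.inj i').hom.hom ⟨a, ha'⟩ := by
    intro t i i' h a ha ha'
    subst h
    rfl
  have hmem : ∀ a : A.obj.V, a ∈ S (e.symm (e (Quotient.mk'' a))) := fun a => by
    rw [memS, Equiv.symm_apply_apply]
  -- the cofan of orbits is a colimit
  have hcol : Nonempty (IsColimit (Cofan.mk A inj)) := by
    refine ⟨Cofan.IsColimit.mk _
      (fun t => ObjectProperty.homMk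
        { hom := TypeCat.ofHom fun a : A.obj.V =>
            ((t.inj (e (Quotient.mk'' a))).hom.hom (⟨a, hmem a⟩ : S _) : t.pt.obj.V)
          comm := fun g => ?_ })
      (fun t i => ?_) (fun t m hm => ?_)⟩
    · apply ConcreteCategory.hom_ext
      intro (a : A.obj.V)
      simp only [types_comp_apply, TypeCat.ofHom_apply]
      change ((t.inj (e (Quotient.mk'' (g • a)))).hom.hom ⟨g • a, hmem (g • a)⟩ : t.pt.obj.V) =
        t.pt.obj.ρ g ((t.inj (e (Quotient.mk'' a))).hom.hom ⟨a, hmem a⟩)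
      have hidx : e (Quotient.mk'' (g • a)) = e (Quotient.mk'' a) := by
        rw [show (Quotient.mk'' (g • a) : MulAction.orbitRel.Quotient G A.obj.V) = Quotient.mk'' a
          from Quotient.sound (MulAction.orbitRel_apply.mpr (MulAction.mem_orbit a g))]
      rw [hdep t _ _ hidx (g • a) (hmem (g • a)) ((S _).smul_mem g (hmem a))]
      exact hom_ρ'' (t.inj (e (Quotient.mk'' a))) g ⟨a, hmem a⟩
    · apply ObjectProperty.hom_ext
      apply Action.hom_ext
      apply ConcreteCategory.hom_ext
      intro y
      change ((t.inj (e (Quotient.mk'' (y.1 : A.obj.V)))).hom.hom ⟨y.1, hmem y.1⟩ : t.pt.obj.V) =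
        (t.inj i).hom.hom y
      have hidx : e (Quotient.mk'' (y.1 : A.obj.V)) = i := by
        rw [(memS _ y.1).mp y.2, Equiv.apply_symm_apply]
      rw [hdep t _ _ hidx y.1 (hmem y.1) y.2]
    · apply ObjectProperty.hom_ext
      apply Action.hom_ext
      apply ConcreteCategory.hom_ext
      intro a
      change (m.hom.hom a : t.pt.obj.V) = (t.inj (e (Quotient.mk'' a))).hom.hom ⟨a, hmem a⟩
      rw [← hm (e (Quotient.mk'' a))]
      rfl
  exact ⟨Set.range f, inferInstance, X, hconn, Cofan.mk A inj, hcol, ⟨Iso.refl A⟩⟩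

variable [IsTopologicalGroup G]

/-- **Connected objects see coproducts as disjoint unions of `Hom`-sets**: for a colimit cofan of
`B^temp(Π)` over a countable index type and a connected object `B`, every `B ⟶ ∐ Xᵢ` factors
through exactly one leg. [cite: MochizukiSemiAnbd2006, Rmk 3.1.5 p.34] -/
theorem BTemp.cofan_bijective {ι : Type} [Countable ι] {X : ι → BTemp G} (c : Cofan X)
    (hc : IsColimit c) (B : BTemp G) (hB : IsConnectedObj B) :
    Function.Bijective fun p : Σ i, (B ⟶ X i) => p.2 ≫ c.inj p.1 := by
  classical
  -- the cofan in `Cofan.mk` form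
  have hc' : IsColimit (Cofan.mk c.pt c.inj) :=
    IsColimit.ofIsoColimit hc (Cocone.ext (Iso.refl _) (by
      rintro ⟨i⟩
      simp only [Cofan.mk_ι_app, Iso.refl_hom]
      rfl))
  obtain ⟨⟨b₀⟩, htrans⟩ := (BTemp.isConnectedObj_iff B).mp hB
  constructor
  · rintro ⟨i, f⟩ ⟨i', f'⟩ h
    have hb : ((c.inj i).hom.hom (f.hom.hom b₀) : c.pt.obj.V) = (c.inj i').hom.hom (f'.hom.hom b₀) :=
      congrArg (fun φ : B ⟶ c.pt => (φ.hom.hom b₀ : c.pt.obj.V)) h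
    obtain rfl := BTemp.cofan_eq_of_inj_apply_eq c.inj hc' _ _ hb
    have hff' : f = f' := by
      apply ObjectProperty.hom_ext
      apply Action.hom_ext
      apply ConcreteCategory.hom_ext
      intro b
      exact BTemp.cofan_inj_injective c.inj hc' i
        (congrArg (fun φ : B ⟶ c.pt => (φ.hom.hom b : c.pt.obj.V)) h)
    rw [hff']
  · intro h
    obtain ⟨i, y₀, hy₀⟩ := BTemp.cofan_inj_jointly_surjective c.inj hc' (h.hom.hom b₀)
    -- every value of `h` lies in the image of the `i`-th leg
    have hex : ∀ b : B.obj.V, ∃ y : (X i).obj.V, ((c.inj i).hom.hom y : c.pt.obj.V) = h.hom.hom b := by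
      intro b
      obtain ⟨g, rfl⟩ := htrans b₀ b
      refine ⟨(X i).obj.ρ g y₀, ?_⟩
      rw [hom_ρ'', hy₀, hom_ρ'']
    choose φ hφ using hex
    have hφρ : ∀ (g : G) (b : B.obj.V), φ (B.obj.ρ g b) = (X i).obj.ρ g (φ b) := by
      intro g b
      apply BTemp.cofan_inj_injective c.inj hc' i
      change ((c.inj i).hom.hom (φ (B.obj.ρ g b)) : c.pt.obj.V) = (c.inj i).hom.hom ((X i).obj.ρ g (φ b))
      rw [hφ, hom_ρ'', hom_ρ'', hφ]
    let fi : B ⟶ X i := ObjectProperty.homMk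
      { hom := TypeCat.ofHom φ
        comm := fun g => by
          apply ConcreteCategory.hom_ext
          intro b
          simp only [types_comp_apply, TypeCat.ofHom_apply]
          exact hφρ g b }
    refine ⟨⟨i, fi⟩, ?_⟩
    apply ObjectProperty.hom_ext
    apply Action.hom_ext
    apply ConcreteCategory.hom_ext
    intro b
    exact hφ b

/-- **`B^temp(Π)` is of countably connected type** ([SemiAnbd] Remark 3.1.5, second clause, for
`B^temp(Π)`): countable coproducts exist, every object is the countable coproduct of its
(connected) orbits, and connected objects see coproducts as disjoint unions of `Hom`-sets.
[cite: MochizukiSemiAnbd2006, Rmk 3.1.5 p.34] -/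
theorem BTemp.isOfCountablyConnectedType : IsOfCountablyConnectedType (BTemp G) where
  hasCountableCoproducts := BTemp.hasCountableCoproducts
  exists_cofan := BTemp.exists_cofan_orbits
  bijective := fun c hc B hB => BTemp.cofan_bijective c hc B hB

end Literature.AnabelianGeometry.SemiGraphs
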